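import Summits.BirchSwinnertonDyer.BirchSwinnertonDyer.Theorems.ByReductionTypeAtTwoRankOneAtTwoBigImageOddLocalOneDoorHalvesBookkeeping
import Summits.BirchSwinnertonDyer.BirchSwinnertonDyer.Theorems.ByReductionTypeAtTwoRankOneAtTwoBigImageOddLocalOneDoorFullCPrimary
import HarnessLib

/-!
# Route ByReductionTypeAtTwo, crux `RankOneAtTwoBigImageOddLocal` (stmt-BirchSwinnertonDyer-23715), LINE v8.6 `one_door_analytic`:
# the crux BY NAME from the two halves of the one door law (composition of skeleton v8.6)

Lead prover seat `bsd-line-fkl-p1` g8 (2026-08-28), `--supports stmt-BirchSwinnertonDyer-23715`.  ONE theorem; conditional by design;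
BSD is not proved by any of this.  The route-independent part (exponent bookkeeping, losslessness of the split
`DoorIndexLawFullCAtTwo ↔ DoorIndexLawUpperCAtTwo ∧ DoorIndexLawLowerCAtTwo` modulo print) is `…OneDoorHalvesBookkeeping.lean`; this
companion imports the route file (through the width seat fkl-p2 g7's `…OneDoorFullCPrimary.lean`) only to conclude the crux by name.

* `rankOneAtTwoBigImageOddLocal_of_oneDoorAnalyticC_halves` — **the crux BY NAME from `gross_zagier`, `kolyvagin`, `exists_isNewformOf`,
  `HoffsteinLuo1997_exists_twist_L_one_ne_zero`, the two halves AN-28c-U / AN-28c-L (conjectures, load-bearing), and the route's four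
  rank-`0` cruxes** — `rankOneAtTwoBigImageOddLocal_of_oneDoorAnalyticC_primary4` composed with `doorIndexLawFullCAtTwo_of_halves`.
  Skeleton v8.6 (`Cruxes/RankOneAtTwoBigImageOddLocal/Lines/one_door_analytic.lean`): stubs `stub_pub4` · `stub_doorUpperC` ·
  `stub_doorLowerC` · `stub_rankZeroAtTwo`.
-/

set_option autoImplicit false

noncomputable section

open scoped Classical

set_option linter.dupNamespace false

namespace Summit.BirchSwinnertonDyer.BirchSwinnertonDyer.Theorems.RankOneAtTwoOneDoor

open WeierstrassCurve NumberField IsDedekindDomain Rat.HeightOneSpectrum Literature.NumberTheory.EllipticCurves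
  Literature.NumberTheory.EllipticCurves.ModularForms
  Literature.NumberTheory.EllipticCurves.KrizLi2019
  Literature.NumberTheory.EllipticCurves.Rank1Residual.Typed
  Summit.BirchSwinnertonDyer.Rank1Residual.F1Sign2
  Summit.BirchSwinnertonDyer.Rank1Residual.F1Sign2.TranspositionDoor
  Summit.BirchSwinnertonDyer.Rank1Residual
  Summit.BirchSwinnertonDyer.BirchSwinnertonDyer.Theses.ByReductionTypeAtTwo


/-! ### §3 The crux by name from the halves (composition of skeleton v8.6) -/

/-- **The crux `RankOneAtTwoBigImageOddLocal` BY NAME from LINE v8.6's inputs**: the four primary printed facts Gross–Zagier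
(`gross_zagier`), Kolyvagin (`kolyvagin`), modularity as a newform (`exists_isNewformOf`), Hoffstein–Luo 1997
(`HoffsteinLuo1997_exists_twist_L_one_ne_zero`); the two halves AN-28c-U / AN-28c-L of the one door law (conjectures, load-bearing);
and the route's four rank-`0` cruxes at `2` BY NAME — the width seat's `rankOneAtTwoBigImageOddLocal_of_oneDoorAnalyticC_primary4` over
`doorIndexLawFullCAtTwo_of_halves`.  BSD is not proved by this: conditional by design. -/
theorem rankOneAtTwoBigImageOddLocal_of_oneDoorAnalyticC_halves
    (hGZ : ∀ (N : ℕ) [NeZero N] (W : WeierstrassCurve ℚ) (K : Type) [Field K] [NumberField K], gross_zagier N W K)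
    (hKo : ∀ (N : ℕ) [NeZero N] (W : WeierstrassCurve ℚ) (K : Type) [Field K] [NumberField K], kolyvagin N W K)
    (hnf : exists_isNewformOf) (hHL : HoffsteinLuo1997_exists_twist_L_one_ne_zero)
    (hU : DoorIndexLawUpperCAtTwo) (hL : DoorIndexLawLowerCAtTwo)
    (hZ4 : GoodOrdinaryRankZeroAtTwo ∧ MultiplicativeRankZeroAtTwo ∧ SupersingularRankZeroAtTwo ∧ AdditiveRankZeroAtTwo) :
    RankOneAtTwoBigImageOddLocal :=
  rankOneAtTwoBigImageOddLocal_of_oneDoorAnalyticC_primary4 hGZ hKo hnf hHL (doorIndexLawFullCAtTwo_of_halves hGZ hKo hnf hU hL) hZ4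

end Summit.BirchSwinnertonDyer.BirchSwinnertonDyer.Theorems.RankOneAtTwoOneDoor

end
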